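import Summits.QuantumFields.YangMills.Theorems.BalabanUVNodesN11TopPairLocalResidual
import Summits.QuantumFields.YangMills.Theorems.BalabanUVNodesN11TwoScaleRowDoor

/-!
# DAG node N11 — THE TOP PAIR READ THROUGH THE DOOR: at every parameter whose step-1 residual factor `ζ_0` has print's NEW-FIELD SHAPE `ζ_0(Y)(ω) = g(Y)(V_1)` ([III] (3.2):
# a function of the NEW gauge field `V_1 = (ω 1).1`), the top pair's new-side prefactor READS THE COARSE FIELD — it is `g(∅)(V′) · e^{−½quad_0(𝕋)(base₁V′)}`, NOT a
# `V′`-independent constant — so g18's rough-set test demands only `g(∅)(V′) = 0` for a.e. ROUGH `V′` of the support; with a (3.2) CUT-OFF profile (vanishing on the rough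
# coarse fields) the test is met IDENTICALLY and the (O3′) clause of the top pair REDUCES EXACTLY to its restriction to the (3.2)-SMALL coarse fields — [III] Thm 1's main
# term is NOT forced absent there (contrast `…N11TopPairLocalResidual` §3–§5 under the displayed ONE-SCALE law `hzh`).  Count-neutral, LOCATED; no pin of record is touched.

HEADER — WORK-UNIT METADATA.  Cell `pub-ymgap`, YM-PLAN Track A (HUMAN RULING D-0062), seat `pub-ymgap-dag-n11-d` (g33; N11 [B14], s2), route `BalabanUVNodes`, item K1⁹ =
stmt-QuantumFields-27364 (helper lane, `--kind proof --supports 27364 --as helper`, count-neutral).  [III] = [Balaban1988Convergent], [B7] = [Balaban1985Averaging], [I] =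
[Balaban1987RG1].  Over this seat's `…N11TopPairLocalResidual` (A; g19∕W2: under `hzh` the prefactor is `c · e^{−½quad}`, `c` constant in `V′`), `…N11TopPairRoughSet` (g18: ★★
`slotsT_one_top_ae_zero_on_rough` — the OLD side vanishes for a.e. rough `V′`, every `θ`; ★★★ `top_prefactor_ae_zero_on_rough_of_O3` — the test), `…N11TopChildTStep.sect2Slot_top_eq_exp`,
`…N11TwoScaleRowDoor` (g32∕g33: residuals of the new-field shape obey 12b's TWO-SCALE row of record and violate `hzh`), node00-def-T's RECORD 13 v1.7 `H` (`Stage13HParams.Zh`, `WtOfRecord₁₃H`).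

WHY THIS FILE.  After the FLAG №1 cure (W2∕T1′, 2026-08-29) the proviso row `zhLocal` is print's TWO-SCALE law, and `…N11TwoScaleRowDoor` certified that it admits residuals whose
generation-`k` factor reads the NEW field `V_{k+1}` — the shape of print's small-field functions `χ_{k+1}` of (3.2) inside `ζ(Ω^c_{k+1})` (p.267).  The located degeneracy of the g18∕g19
readings («the first 𝐓-law serves every top pair only degenerately») is a theorem about parameters whose step-1 residual obeys the ONE-SCALE law `hzh`; this file re-runs the SAME reading
(A §1–§3) at every `θ : Stage13HParams F N` whose step-1 residual factor of generation `0` along the top history `s′ = (𝕋, 𝕋)` has the new-field shape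
`hζ : ∀ Y ω, (θ.Zh p 1 s′.Ω s′.Λ).ζ0 0 Y ω = g Y (ω 1).1` (DISPLAYED; inhabited next to every `θ` with all other data unchanged, §0), and finds it NON-DEGENERATE:
§1 the factor READS `V′` at 11a's base configuration (`= g Y V′`); §2 the prefactor is `g ∅ V′ · e^{−½quad_0(𝕋)(base₁V′)}`, zero exactly where `g ∅ V′ = 0`, and the new side of the top
pair is `g ∅ V′ · e^{−½quad} · exp A_1(s′)(U(base₁V′))`; §3 g18's test under (O3′) now reads «`slotT ≡ 0` OR `g ∅ V′ = 0` for a.e. rough `V′` of the support» — a condition ON THE PROFILE,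
met identically by every profile CUT OFF on the rough coarse fields (`hcut : ¬PlaqSmall(2α₀(Lη₁)²) V′ → g ∅ V′ = 0`), for which the new side vanishes on the rough fields exactly where g18
proved the old side does; §4 hence, for cut-off profiles, (O3′) at the top pair ⟺ «`slotT ≡ 0` OR old side = new side a.e. on the (3.2)-SMALL fields of the support» — and for an
indicator profile (`g ∅ V′ = 1` on the small fields) the new side there is `e^{−½quad_0(𝕋)(base₁V′)} · exp A_1(s′)(U(base₁V′))`, the SHAPE of [III] Thm 1's main term ([I] Thm 1
(0.22)–(0.25)) with NO vanishing constant in front.  What such a `θ` must still satisfy at the top pair is therefore print's first-step identity on the small fields — content of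
[III] Thm 1 proper, NOT proved here — and nothing forces its 𝐓-slot to vanish.  This is the kernel form of the door the cure opened, generic in the pin (K0a∕K0b's to posit).

WHAT THIS FILE PROVES (0 `def`, 0 `sorry`, standard axioms).  §0 `exists_zh_newFieldShape` (next to every `θ`: same `Stage13RParams` data, same `Phih`, same `quad`, residual factor of the
new-field shape at generation `0` — the shape hypothesis is jointly inhabited with everything else a `Stage13HParams` carries) · `localLaws_zh_of_newFieldShape` (such a residual OBEYS
the row of record, via `…TwoScaleRowDoor`).  §1 ★ `WtOfRecord₁₃H_ζ_baseCfg_of_newFieldShape` (`ζ_0(Y)(base₁V′) = g Y V′`: READS `V′`).  §2 ★★ `top_prefactor_eq_of_newFieldShape` ·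
★★ `top_prefactor_eq_zero_iff_of_newFieldShape` (`= 0 ↔ g ∅ V′ = 0`, `V′`-DEPENDENT) · ★★ `sect2Slot_top_pair_eq_of_newFieldShape` · `sect2Slot_top_pair_eq_zero_of_cutoff` (rough `V′`) ·
`sect2Slot_top_pair_eq_main_of_indicator` (small `V′`).  §3 ★★★ `top_O3_profile_test_of_newFieldShape` ((O3′) ⇒ `slotT ≡ 0 ∨` a.e. on the rough support `g ∅ V′ = 0`) · ★★★
`rough_test_met_of_cutoff` (the conclusion of g18's test holds OUTRIGHT for cut-off profiles — no (O3′), no guards).  §4 ★★★★ `top_O3_iff_small_of_cutoff` ((O3′) ⟺ `slotT ≡ 0 ∨`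
the identity a.e. on the SMALL fields of the support).  §5 ★★★★★
`tLaw₁₃CoPH_zero_top_pair_small_identity_of_cutoff` (`TLaw₁₃CoPH θ p 0` ⇒ at every top pair the small-field identity, with the law's own terms) — the converse is `(top_O3_iff_small_of_cutoff …).2`:
the small-field identity alone serves the top pair's (O3′) clause, the rough fields impose nothing.  §6 the profile `g Y V′ = 𝟙{PlaqSmall(2α₀(Lη₁)²) V′}` — print's (3.2)
characteristic function of the new field: `smallFieldIndicator_cut` · `smallFieldIndicator_one` · `plaqSmall_one_of_pos` · `smallFieldThreshold_pos` · ★★ `not_oneScale_of_newFieldShape_of_sep` · ★★ `not_oneScale_of_indicator`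
(`hzh` FAILS as soon as one rough coarse field exists — so A §2–§5 do not apply) · ★★★★★ `top_O3_iff_main_term_on_small_of_indicatorShape` (§4 with `hcut` discharged and the new side on the small fields DISPLAYED as the main term `e^{−½quad}·exp A_1`, no constant in front).

HONEST FRAMING.  A READING on the tree's own rows and objects (count-neutral, LOCATED): nothing of Bałaban asserted or refuted — print's `ζ(Ω^c_{k+1})` is a specific resummation
(p.267) of which `g` is only the SHAPE, and the first-step identity on the small fields ([III] Thm 1) is DISPLAYED as one side of an `↔`, never claimed; K1⁹'s `∃θ` NOT advanced and NOT
refuted; no `Stage13HParams` of record is constructed or modified (§0 is an anonymous-constructor inhabitation next to an arbitrary `θ`); N11 NOT discharged; K1⁹ NOT closed; no registered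
stub touched; counts unmoved (typed 28∕28 · discharged 8∕27).  One finite four-torus programme at fixed `ε = L^{−K}`; NOT ℝ⁴, NOT OS, NOT a mass gap, NOT Clay.  No `sorry`, `axiom`,
`def`, `instance`, `notation`.  Sources (SHAPE only): [III] Thm 1 p.262, (2.18) p.257, (2.21)–(2.23) p.258, p.267, (3.1)–(3.5) pp.264–265, (3.25) p.270; [B7] Prop. 2 (52)–(54) p.26;
[I] Thm 1 p.259, (0.22)–(0.25) p.253.
-/

noncomputable section

open MeasureTheory
open scoped BigOperators Matrix.Norms.L2Operator

namespace Summit.QuantumFields.YangMills.Theorems.BalabanUVNodesN11TopPairAtNewFieldShape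

open Literature.MathematicalPhysics.QuantumFieldTheory.Balaban1983to89 T4Continuum Node00 Node00.Tk B14.Eq218Concrete B14.Sect3Decomp
open Literature.MathematicalPhysics.QuantumFieldTheory.Balaban1983to89.ExpMeanLog (deltaSU)
open B14.Eq213MaximalDomains (side)
open BalabanUVNodesN11TopChildTStep (sect2Slot_top_eq_exp)
open BalabanUVNodesN11TopPairRoughSet (slotsT_one_top_ae_zero_on_rough top_prefactor_ae_zero_on_rough_of_O3)
open BalabanUVNodesN11TopPairLocalResidual (WtOfRecord₁₃H_ζ_eq_ζ0 WtOfRecord₁₃H_w_univ_empty_empty)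
open BalabanUVNodesN11TwoScaleRowDoor (localLaws_of_newFieldShape)
open BalabanUVNodesN11AllLargeFieldLabel (sideD_pos sideχ_pos)

variable {F : T4Family} {N : ℕ} [NeZero N]

/-! ## §0. The shape hypothesis is inhabited next to every `θ`, and such residuals obey the row of record -/

section Inhabited

/-- **NEXT TO EVERY `θ` THERE IS ONE WHOSE RESIDUAL FACTOR HAS THE NEW-FIELD SHAPE AT GENERATION `0`** — same `Stage13RParams` data (torus numerics, couplings, backgrounds, step
weights, selectors, …), same smearing functions `Phih`, same quadratic forms `quad`; only `ζ0` is replaced by `ζ0 0 Y ω := g p n Ω Λ Y (ω 1).1`, `ζ0 j := 1` for `j ≥ 1`.  (An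
anonymous-constructor inhabitation of the DISPLAYED hypothesis of this file; no parameter of record is built.) [cite: Balaban1988Convergent, (3.2) p.265, p.267 (shape only)] -/
theorem exists_zh_newFieldShape (θ : Stage13HParams F N)
    (g : (p : B12.RunParams) → ℕ → (ℕ → Set (Site (F.P p.K) 0)) → (ℕ → Set (Site (F.P p.K) 0)) → Set (Site (F.P p.K) 0) → GaugeField (F.P p.K) 1 (SU N) → ℝ) :
    ∃ θ' : Stage13HParams F N, θ'.toStage13RParams = θ.toStage13RParams ∧ θ'.Phih = θ.Phih ∧
      (∀ p n Ω Λ j Y ω, (θ'.Zh p n Ω Λ).quad j Y ω = (θ.Zh p n Ω Λ).quad j Y ω) ∧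
      ∀ p n Ω Λ j Y ω, (θ'.Zh p n Ω Λ).ζ0 j Y ω = if j = 0 then g p n Ω Λ Y (ω 1).1 else 1 :=
  ⟨{ θ with Zh := fun p n Ω Λ => ⟨fun j Y ω => if j = 0 then g p n Ω Λ Y (ω 1).1 else 1, (θ.Zh p n Ω Λ).quad⟩ }, rfl, rfl, fun _ _ _ _ _ _ _ => rfl,
    fun _ _ _ _ _ _ _ => rfl⟩

/-- **A RESIDUAL OF THE NEW-FIELD SHAPE OBEYS 12b's ROW OF RECORD** `TkResidualW.LocalLaws` (TWO-SCALE since W2∕T1′) — `…N11TwoScaleRowDoor.localLaws_of_newFieldShape` at `k = 0` read at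
the history-indexed slot: the proviso row `zhLocal` of `Provisos₁₃CoPH` is met AT this `(p, n, Ω, Λ)` by such a factor. [cite: Balaban1988Convergent, (3.1) p.264, (3.2)–(3.4) p.265, p.267] -/
theorem localLaws_zh_of_newFieldShape (θ : Stage13HParams F N) (p : B12.RunParams) (n : ℕ) (Ω Λ : ℕ → Set (Site (F.P p.K) 0))
    {g : Set (Site (F.P p.K) 0) → GaugeField (F.P p.K) 1 (SU N) → ℝ} (hZh : ∀ j Y ω, (θ.Zh p n Ω Λ).ζ0 j Y ω = if j = 0 then g Y (ω 1).1 else 1) :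
    (θ.Zh p n Ω Λ).LocalLaws :=
  localLaws_of_newFieldShape (k := 0) hZh

end Inhabited

/-! ## §1. At 11a's base configuration the factor READS the coarse field (contrast `…N11TopPairLocalResidual.WtOfRecord₁₃H_ζ_baseCfg_eq_of_localLaws`) -/

section Reading

variable (θ : Stage13HParams F N) (p : B12.RunParams)

/-- ★ **`ζ_0(Y)(base₁V′) = g Y V′` AT EVERY `θ` WHOSE GENERATION-0 FACTOR HAS THE NEW-FIELD SHAPE**: the level-`1` component of `base₁(V′)` IS `V′`, and the factor reads exactly that
component — so the value DEPENDS on `V′` (under the one-scale law `hzh` it did not: A §1). [cite: Balaban1988Convergent, (2.18) p.257, (3.2) p.265, p.267] -/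
theorem WtOfRecord₁₃H_ζ_baseCfg_of_newFieldShape {n : ℕ} (s : SeqOfRecord F θ.ν θ.τ9.M (gOfRecord₁₃ F N θ.toStage13Params p) p.K n)
    {g : Set (Site (F.P p.K) 0) → GaugeField (F.P p.K) 1 (SU N) → ℝ} (hζ : ∀ Y ω, (θ.Zh p n s.Ω s.Λ).ζ0 0 Y ω = g Y (ω 1).1)
    (Y : Set (Site (F.P p.K) 0)) (V' : GaugeField (F.P p.K) 1 (SU N)) :
    (WtOfRecord₁₃H F N θ p s).ζ 0 Y (baseCfg (V := FluctV N) 1 V') = g Y V' := by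
  rw [WtOfRecord₁₃H_ζ_eq_ζ0, hζ]
  exact congrArg (g Y) (funext fun b => baseCfg_fst_self (V := FluctV N) 1 V' b)

end Reading

/-! ## §2. The top pair's new-side prefactor: `g ∅ V′ · e^{−½quad_0(𝕋)(base₁V′)}` — it vanishes exactly where the profile does -/

section Prefactor

variable (θ : Stage13HParams F N) (p : B12.RunParams)

/-- ★★ **THE PREFACTOR IS `g ∅ V′ · e^{−½quad_0(𝕋)(base₁V′)}`** — the profile read AT `V′` times a positive exponential (A §2 had the constant `c = ζ_0(∅)(base₁ 1)` in place of `g ∅ V′`).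
[cite: Balaban1988Convergent, (2.18) p.257, (2.21)–(2.22) p.258, p.267, (3.2) p.265] -/
theorem top_prefactor_eq_of_newFieldShape (s' : SeqOfRecord F θ.ν θ.τ9.M (gOfRecord₁₃ F N θ.toStage13Params p) p.K 1)
    {g : Set (Site (F.P p.K) 0) → GaugeField (F.P p.K) 1 (SU N) → ℝ} (hζ : ∀ Y ω, (θ.Zh p 1 s'.Ω s'.Λ).ζ0 0 Y ω = g Y (ω 1).1) (V' : GaugeField (F.P p.K) 1 (SU N)) :
    (WtOfRecord₁₃H F N θ p s').ζ 0 ∅ (baseCfg (V := FluctV N) 1 V') * (WtOfRecord₁₃H F N θ p s').w 0 Set.univ ∅ ∅ (baseCfg (V := FluctV N) 1 V') =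
      g ∅ V' * Real.exp (-(1 / 2 : ℝ) * (θ.Zh p 1 s'.Ω s'.Λ).quad 0 Set.univ (baseCfg (V := FluctV N) 1 V')) := by
  rw [WtOfRecord₁₃H_ζ_baseCfg_of_newFieldShape θ p s' hζ ∅ V', WtOfRecord₁₃H_w_univ_empty_empty]

/-- ★★ **… SO IT VANISHES AT `V′` IFF `g ∅ V′ = 0`** — a condition that DEPENDS ON `V′` (A §2: iff the constant `c` vanishes, the same for every `V′`).
[cite: Balaban1988Convergent, (2.21)–(2.22) p.258, p.267, (3.2) p.265 (bookkeeping)] -/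
theorem top_prefactor_eq_zero_iff_of_newFieldShape (s' : SeqOfRecord F θ.ν θ.τ9.M (gOfRecord₁₃ F N θ.toStage13Params p) p.K 1)
    {g : Set (Site (F.P p.K) 0) → GaugeField (F.P p.K) 1 (SU N) → ℝ} (hζ : ∀ Y ω, (θ.Zh p 1 s'.Ω s'.Λ).ζ0 0 Y ω = g Y (ω 1).1) (V' : GaugeField (F.P p.K) 1 (SU N)) :
    (WtOfRecord₁₃H F N θ p s').ζ 0 ∅ (baseCfg (V := FluctV N) 1 V') * (WtOfRecord₁₃H F N θ p s').w 0 Set.univ ∅ ∅ (baseCfg (V := FluctV N) 1 V') = 0 ↔ g ∅ V' = 0 := by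
  rw [top_prefactor_eq_of_newFieldShape θ p s' hζ V', mul_eq_zero, or_iff_left (Real.exp_pos _).ne']

/-- ★★ **THE NEW SIDE OF THE TOP PAIR**: `sect2Slot(W^θ(s′), s′, u₁, e₁, U)(V′) = g ∅ V′ · e^{−½quad_0(𝕋)(base₁V′)} · exp A_1(s′; u₁, (∅,0), e₁)(U(base-gauge₁V′))` at `s′ = (𝕋, 𝕋)`.
[cite: Balaban1988Convergent, (2.18) p.257, (2.22)–(2.23) p.258, (3.23)–(3.25) p.270, (3.2) p.265; Balaban1987RG1, Thm 1 p.259] -/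
theorem sect2Slot_top_pair_eq_of_newFieldShape (s' : SeqOfRecord F θ.ν θ.τ9.M (gOfRecord₁₃ F N θ.toStage13Params p) p.K 1)
    {g : Set (Site (F.P p.K) 0) → GaugeField (F.P p.K) 1 (SU N) → ℝ} (hζ : ∀ Y ω, (θ.Zh p 1 s'.Ω s'.Λ).ζ0 0 Y ω = g Y (ω 1).1) (hΩ : s'.Ω 1 = Set.univ) (hΛ : s'.Λ 1 = Set.univ)
    (Sg : Sect2.Setting (MatA N) (SU N)) (Rz : Sect2.Residual (F.P p.K) (MatA N)) (u₁ : Sect2.TermValues (F.P p.K) (MatA N) (FluctV N) θ.τ9.M) (e₁ : ℝ) (U : BgMap F N p.K)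
    (V' : GaugeField (F.P p.K) 1 (SU N)) :
    sect2Slot F N (FluctV N) p.K Sg Rz (WtOfRecord₁₃H F N θ p s') s' u₁ e₁ U V' =
      g ∅ V' * Real.exp (-(1 / 2 : ℝ) * (θ.Zh p 1 s'.Ω s'.Λ).quad 0 Set.univ (baseCfg (V := FluctV N) 1 V')) *
        Real.exp ((sect2ActionDataOfRecord F N (FluctV N) p.K Sg Rz s' u₁ (fun _ => ∅, fun _ => 0) e₁).action23 1
          (U (fun j => ((baseCfg (V := FluctV N) 1 V') j).1))) := by
  rw [sect2Slot_top_eq_exp (FluctV N) p.K Sg Rz (WtOfRecord₁₃H F N θ p s') s' hΩ hΛ u₁ e₁ U V', Finset.prod_range_one,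
    top_prefactor_eq_of_newFieldShape θ p s' hζ V']

/-- **ON A ROUGH COARSE FIELD A CUT-OFF PROFILE KILLS THE NEW SIDE** (`hcut`: `g ∅` vanishes off the `2α₀(Lη₁)²`-plaquette-small fields — the SHAPE of print's (3.2) small-field
functions of `V_1`): `sect2Slot(…)(V′) = 0` at every `V′` with `¬PlaqSmall(2α₀(Lη₁)²) V′`. [cite: Balaban1988Convergent, (3.2) p.265, p.267, (3.25) p.270 (bookkeeping)] -/
theorem sect2Slot_top_pair_eq_zero_of_cutoff (s' : SeqOfRecord F θ.ν θ.τ9.M (gOfRecord₁₃ F N θ.toStage13Params p) p.K 1)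
    {g : Set (Site (F.P p.K) 0) → GaugeField (F.P p.K) 1 (SU N) → ℝ} (hζ : ∀ Y ω, (θ.Zh p 1 s'.Ω s'.Λ).ζ0 0 Y ω = g Y (ω 1).1) (hΩ : s'.Ω 1 = Set.univ) (hΛ : s'.Λ 1 = Set.univ)
    {α₀ : ℝ} (hcut : ∀ V', ¬ PlaqSmall (2 * α₀ * (((F.P p.K).L : ℝ) ^ 1 * (F.P p.K).eta 1) ^ 2) V' → g ∅ V' = 0)
    (Sg : Sect2.Setting (MatA N) (SU N)) (Rz : Sect2.Residual (F.P p.K) (MatA N)) (u₁ : Sect2.TermValues (F.P p.K) (MatA N) (FluctV N) θ.τ9.M) (e₁ : ℝ) (U : BgMap F N p.K)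
    {V' : GaugeField (F.P p.K) 1 (SU N)} (hV' : ¬ PlaqSmall (2 * α₀ * (((F.P p.K).L : ℝ) ^ 1 * (F.P p.K).eta 1) ^ 2) V') :
    sect2Slot F N (FluctV N) p.K Sg Rz (WtOfRecord₁₃H F N θ p s') s' u₁ e₁ U V' = 0 := by
  rw [sect2Slot_top_pair_eq_of_newFieldShape θ p s' hζ hΩ hΛ Sg Rz u₁ e₁ U V', hcut V' hV', zero_mul, zero_mul]

/-- **ON A (3.2)-SMALL COARSE FIELD AN INDICATOR PROFILE GIVES THE MAIN TERM WITH NO CONSTANT IN FRONT** (`hone`: `g ∅ V′ = 1` on the `2α₀(Lη₁)²`-plaquette-small fields):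
`sect2Slot(…)(V′) = e^{−½quad_0(𝕋)(base₁V′)} · exp A_1(s′; u₁, (∅,0), e₁)(U(base-gauge₁V′))` — the SHAPE of [III] Thm 1's main term ([I] Thm 1 (0.22)–(0.25)).
[cite: Balaban1988Convergent, Thm 1 p.262, (3.2) p.265, (3.25) p.270; Balaban1987RG1, Thm 1 p.259, (0.22)–(0.25) p.253 (shape only)] -/
theorem sect2Slot_top_pair_eq_main_of_indicator (s' : SeqOfRecord F θ.ν θ.τ9.M (gOfRecord₁₃ F N θ.toStage13Params p) p.K 1)
    {g : Set (Site (F.P p.K) 0) → GaugeField (F.P p.K) 1 (SU N) → ℝ} (hζ : ∀ Y ω, (θ.Zh p 1 s'.Ω s'.Λ).ζ0 0 Y ω = g Y (ω 1).1) (hΩ : s'.Ω 1 = Set.univ) (hΛ : s'.Λ 1 = Set.univ)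
    {α₀ : ℝ} (hone : ∀ V', PlaqSmall (2 * α₀ * (((F.P p.K).L : ℝ) ^ 1 * (F.P p.K).eta 1) ^ 2) V' → g ∅ V' = 1)
    (Sg : Sect2.Setting (MatA N) (SU N)) (Rz : Sect2.Residual (F.P p.K) (MatA N)) (u₁ : Sect2.TermValues (F.P p.K) (MatA N) (FluctV N) θ.τ9.M) (e₁ : ℝ) (U : BgMap F N p.K)
    {V' : GaugeField (F.P p.K) 1 (SU N)} (hV' : PlaqSmall (2 * α₀ * (((F.P p.K).L : ℝ) ^ 1 * (F.P p.K).eta 1) ^ 2) V') :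
    sect2Slot F N (FluctV N) p.K Sg Rz (WtOfRecord₁₃H F N θ p s') s' u₁ e₁ U V' =
      Real.exp (-(1 / 2 : ℝ) * (θ.Zh p 1 s'.Ω s'.Λ).quad 0 Set.univ (baseCfg (V := FluctV N) 1 V')) *
        Real.exp ((sect2ActionDataOfRecord F N (FluctV N) p.K Sg Rz s' u₁ (fun _ => ∅, fun _ => 0) e₁).action23 1
          (U (fun j => ((baseCfg (V := FluctV N) 1 V') j).1))) := by
  rw [sect2Slot_top_pair_eq_of_newFieldShape θ p s' hζ hΩ hΛ Sg Rz u₁ e₁ U V', hone V' hV', one_mul]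

end Prefactor

/-! ## §3. g18's rough-set test at the door: a condition on the PROFILE, met identically by every cut-off profile -/

section Test

variable (θ : Stage13HParams F N) (p : B12.RunParams)

/-- ★★★ **THE TEST AT EVERY `θ` WHOSE GENERATION-0 FACTOR HAS THE NEW-FIELD SHAPE** (Stage-13 record, `1 ≤ M`, `0 < M₂`, `0 < K`, the `α₀` guards, `ε₁η₁² + 8δ₀ ≤ α₀η₁²`): for
`s′ = (𝕋, 𝕋)` and any first-step terms `(u₁, e₁)`, (O3′) at the top pair implies `slotT_1(s′) ≡ 0` OR `g ∅ V′ = 0` for a.e. `V′` with `χ₁(s′)V′ ≠ 0` and `¬PlaqSmall(2α₀(Lη₁)²) V′` —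
a condition on the PROFILE over the rough part of the support (A §3 had the `V′`-independent «`c = 0` or that set is null»).
[cite: Balaban1988Convergent, Thm 1 p.262, (3.1)–(3.5) pp.264–265, (3.25) p.270, p.267; Balaban1985Averaging, Prop. 2 (53) p.26] -/
theorem top_O3_profile_test_of_newFieldShape (hM : 1 ≤ θ.τ9.M) (hM₂ : 0 < θ.ν.M₂) (hK : 0 < p.K) {α₀ : ℝ} (hα : 0 < α₀)
    (hα3 : (143 * (((((F.P p.K).d + 4 : ℕ) : ℝ)) ^ 2 / 4) ^ 2) * α₀ ≤ 1 / 3)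
    (hα2 : 2 * α₀ ≤ 2 * deltaSU (Fin N) / ((((F.P p.K).d + 4) * (F.P p.K).L : ℕ) : ℝ) ^ 2)
    (hαε : epsOfRecord θ.ν (gOfRecord₁₃ F N θ.toStage13Params p) 1 * (F.P p.K).eta 1 ^ 2 + 4 * (2 * deltaOfRecord θ.ν (gOfRecord₁₃ F N θ.toStage13Params p) 0 θ.A₁) ≤
      α₀ * (F.P p.K).eta 1 ^ 2)
    (s' : SeqOfRecord F θ.ν θ.τ9.M (gOfRecord₁₃ F N θ.toStage13Params p) p.K 1)
    {g : Set (Site (F.P p.K) 0) → GaugeField (F.P p.K) 1 (SU N) → ℝ} (hζ : ∀ Y ω, (θ.Zh p 1 s'.Ω s'.Λ).ζ0 0 Y ω = g Y (ω 1).1) (hΩ : s'.Ω 1 = Set.univ) (hΛ : s'.Λ 1 = Set.univ)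
    (u₁ : Sect2.TermValues (F.P p.K) (MatA N) (FluctV N) θ.τ9.M) (e₁ : ℝ)
    (hO3 : slotsTOfRecord F N θ.ν θ.τ9 (EOfRecord₁₃ F N θ.toStage13Params) (wOfRecord₉ F N θ.toStage9Params) θ.ppSel p (gOfRecord₁₃ F N θ.toStage13Params p) 1 s' = 0 ∨
      ∀ᵐ V' ∂fieldMeasure (F.P p.K) 1 (SU N),
        chiSeqOfRecord F N θ.ν θ.τ9.M (gOfRecord₁₃ F N θ.toStage13Params p) p.K 1 s' V' ≠ 0 →
          slotsTOfRecord F N θ.ν θ.τ9 (EOfRecord₁₃ F N θ.toStage13Params) (wOfRecord₉ F N θ.toStage9Params) θ.ppSel p (gOfRecord₁₃ F N θ.toStage13Params p) 1 s' V' =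
            sect2Slot F N (FluctV N) p.K (settingOfRecord₁₃ F N θ.toStage13Params p) (θ.rzAt p s') (WtOfRecord₁₃H F N θ p s') s' u₁ e₁
              (UbgOfRecord₁₃CoP F N θ.toStage13Params p 1 s') V') :
    slotsTOfRecord F N θ.ν θ.τ9 (EOfRecord₁₃ F N θ.toStage13Params) (wOfRecord₉ F N θ.toStage9Params) θ.ppSel p (gOfRecord₁₃ F N θ.toStage13Params p) 1 s' = 0 ∨
      ∀ᵐ V' ∂fieldMeasure (F.P p.K) 1 (SU N),
        chiSeqOfRecord F N θ.ν θ.τ9.M (gOfRecord₁₃ F N θ.toStage13Params p) p.K 1 s' V' ≠ 0 →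
          ¬ PlaqSmall (2 * α₀ * (((F.P p.K).L : ℝ) ^ 1 * (F.P p.K).eta 1) ^ 2) V' → g ∅ V' = 0 := by
  rcases top_prefactor_ae_zero_on_rough_of_O3 θ p hM hM₂ hK hα hα3 hα2 hαε s' hΩ hΛ u₁ e₁ hO3 with h0 | hae
  · exact Or.inl h0
  · refine Or.inr ?_
    filter_upwards [hae] with V' hV' hχ hrough
    exact (top_prefactor_eq_zero_iff_of_newFieldShape θ p s' hζ V').1 (hV' hχ hrough)

/-- ★★★ **FOR A CUT-OFF PROFILE THE CONCLUSION OF g18's TEST HOLDS OUTRIGHT** — at EVERY coarse field, with NO (O3′) hypothesis and NO numerics guard: the prefactor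
`ζ_0(∅)(base₁V′)·w_0(𝕋,∅,∅)(base₁V′)` vanishes wherever `¬PlaqSmall(2α₀(Lη₁)²) V′`.  So the necessary condition that killed the main term under `hzh` (A §3–§5) extracts NOTHING
from a parameter whose step-1 residual carries the (3.2) cut-off of the new field. [cite: Balaban1988Convergent, (3.2) p.265, p.267, (2.21)–(2.22) p.258 (bookkeeping)] -/
theorem rough_test_met_of_cutoff (s' : SeqOfRecord F θ.ν θ.τ9.M (gOfRecord₁₃ F N θ.toStage13Params p) p.K 1)
    {g : Set (Site (F.P p.K) 0) → GaugeField (F.P p.K) 1 (SU N) → ℝ} (hζ : ∀ Y ω, (θ.Zh p 1 s'.Ω s'.Λ).ζ0 0 Y ω = g Y (ω 1).1)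
    {α₀ : ℝ} (hcut : ∀ V', ¬ PlaqSmall (2 * α₀ * (((F.P p.K).L : ℝ) ^ 1 * (F.P p.K).eta 1) ^ 2) V' → g ∅ V' = 0)
    (V' : GaugeField (F.P p.K) 1 (SU N)) (hV' : ¬ PlaqSmall (2 * α₀ * (((F.P p.K).L : ℝ) ^ 1 * (F.P p.K).eta 1) ^ 2) V') :
    (WtOfRecord₁₃H F N θ p s').ζ 0 ∅ (baseCfg (V := FluctV N) 1 V') * (WtOfRecord₁₃H F N θ p s').w 0 Set.univ ∅ ∅ (baseCfg (V := FluctV N) 1 V') = 0 :=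
  (top_prefactor_eq_zero_iff_of_newFieldShape θ p s' hζ V').2 (hcut V' hV')

end Test

/-! ## §4. For cut-off profiles the (O3′) clause of the top pair IS its restriction to the (3.2)-small coarse fields -/

section Door

variable (θ : Stage13HParams F N) (p : B12.RunParams)

/-- ★★★★ **THE (O3′) CLAUSE OF THE TOP PAIR REDUCES EXACTLY TO THE SMALL FIELDS** at every `θ` whose generation-0 factor has the new-field shape with a CUT-OFF profile (Stage-13
record, `1 ≤ M`, `0 < M₂`, `0 < K`, the `α₀` guards, `ε₁η₁² + 8δ₀ ≤ α₀η₁²`; `s′ = (𝕋, 𝕋)`): (O3′) ⟺ `slotT_1(s′) ≡ 0` OR «old side `=` new side» for a.e. `V′` with `χ₁(s′)V′ ≠ 0` AND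
`PlaqSmall(2α₀(Lη₁)²) V′`.  (⇐): on the rough fields both sides vanish a.e. — the old side by g18's `slotsT_one_top_ae_zero_on_rough` ([B7] Prop. 2), the new side by the cut-off.  Nothing
here forces `slotT_1(s′) ≡ 0`: what is left is print's first-step identity on the small fields ([III] Thm 1 — DISPLAYED as the right-hand side, not proved).
[cite: Balaban1988Convergent, Thm 1 p.262, (3.1)–(3.5) pp.264–265, (3.25) p.270, p.267; Balaban1985Averaging, Prop. 2 (52)–(54) p.26; Balaban1987RG1, Thm 1 p.259] -/
theorem top_O3_iff_small_of_cutoff (hM : 1 ≤ θ.τ9.M) (hM₂ : 0 < θ.ν.M₂) (hK : 0 < p.K) {α₀ : ℝ} (hα : 0 < α₀)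
    (hα3 : (143 * (((((F.P p.K).d + 4 : ℕ) : ℝ)) ^ 2 / 4) ^ 2) * α₀ ≤ 1 / 3)
    (hα2 : 2 * α₀ ≤ 2 * deltaSU (Fin N) / ((((F.P p.K).d + 4) * (F.P p.K).L : ℕ) : ℝ) ^ 2)
    (hαε : epsOfRecord θ.ν (gOfRecord₁₃ F N θ.toStage13Params p) 1 * (F.P p.K).eta 1 ^ 2 + 4 * (2 * deltaOfRecord θ.ν (gOfRecord₁₃ F N θ.toStage13Params p) 0 θ.A₁) ≤
      α₀ * (F.P p.K).eta 1 ^ 2)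
    (s' : SeqOfRecord F θ.ν θ.τ9.M (gOfRecord₁₃ F N θ.toStage13Params p) p.K 1)
    {g : Set (Site (F.P p.K) 0) → GaugeField (F.P p.K) 1 (SU N) → ℝ} (hζ : ∀ Y ω, (θ.Zh p 1 s'.Ω s'.Λ).ζ0 0 Y ω = g Y (ω 1).1) (hΩ : s'.Ω 1 = Set.univ) (hΛ : s'.Λ 1 = Set.univ)
    (hcut : ∀ V', ¬ PlaqSmall (2 * α₀ * (((F.P p.K).L : ℝ) ^ 1 * (F.P p.K).eta 1) ^ 2) V' → g ∅ V' = 0)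
    (u₁ : Sect2.TermValues (F.P p.K) (MatA N) (FluctV N) θ.τ9.M) (e₁ : ℝ) :
    (slotsTOfRecord F N θ.ν θ.τ9 (EOfRecord₁₃ F N θ.toStage13Params) (wOfRecord₉ F N θ.toStage9Params) θ.ppSel p (gOfRecord₁₃ F N θ.toStage13Params p) 1 s' = 0 ∨
      ∀ᵐ V' ∂fieldMeasure (F.P p.K) 1 (SU N),
        chiSeqOfRecord F N θ.ν θ.τ9.M (gOfRecord₁₃ F N θ.toStage13Params p) p.K 1 s' V' ≠ 0 →
          slotsTOfRecord F N θ.ν θ.τ9 (EOfRecord₁₃ F N θ.toStage13Params) (wOfRecord₉ F N θ.toStage9Params) θ.ppSel p (gOfRecord₁₃ F N θ.toStage13Params p) 1 s' V' =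
            sect2Slot F N (FluctV N) p.K (settingOfRecord₁₃ F N θ.toStage13Params p) (θ.rzAt p s') (WtOfRecord₁₃H F N θ p s') s' u₁ e₁
              (UbgOfRecord₁₃CoP F N θ.toStage13Params p 1 s') V') ↔
    (slotsTOfRecord F N θ.ν θ.τ9 (EOfRecord₁₃ F N θ.toStage13Params) (wOfRecord₉ F N θ.toStage9Params) θ.ppSel p (gOfRecord₁₃ F N θ.toStage13Params p) 1 s' = 0 ∨
      ∀ᵐ V' ∂fieldMeasure (F.P p.K) 1 (SU N),
        chiSeqOfRecord F N θ.ν θ.τ9.M (gOfRecord₁₃ F N θ.toStage13Params p) p.K 1 s' V' ≠ 0 →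
          PlaqSmall (2 * α₀ * (((F.P p.K).L : ℝ) ^ 1 * (F.P p.K).eta 1) ^ 2) V' →
            slotsTOfRecord F N θ.ν θ.τ9 (EOfRecord₁₃ F N θ.toStage13Params) (wOfRecord₉ F N θ.toStage9Params) θ.ppSel p (gOfRecord₁₃ F N θ.toStage13Params p) 1 s' V' =
              sect2Slot F N (FluctV N) p.K (settingOfRecord₁₃ F N θ.toStage13Params p) (θ.rzAt p s') (WtOfRecord₁₃H F N θ p s') s' u₁ e₁
                (UbgOfRecord₁₃CoP F N θ.toStage13Params p 1 s') V') := by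
  refine or_congr_right ⟨fun h => ?_, fun h => ?_⟩
  · filter_upwards [h] with V' hV' hχ _
    exact hV' hχ
  · have hz := slotsT_one_top_ae_zero_on_rough θ.ν θ.τ9 (EOfRecord₁₃ F N θ.toStage13Params) θ.A₁ θ.ζ θ.ppSel p (gOfRecord₁₃ F N θ.toStage13Params p) hK
      (sideD_pos θ.ν hM p _ 0) (sideχ_pos hM₂ p _ 0) hα hα3 hα2 hαε s' hΩ hΛ
    filter_upwards [h, hz] with V' hV' hzV' hχ
    by_cases hs : PlaqSmall (2 * α₀ * (((F.P p.K).L : ℝ) ^ 1 * (F.P p.K).eta 1) ^ 2) V'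
    · exact hV' hχ hs
    · rw [hzV' hs, sect2Slot_top_pair_eq_zero_of_cutoff θ p s' hζ hΩ hΛ hcut _ _ u₁ e₁ _ hs]

end Door


/-! ## §5. The first 𝐓-law of the record at such a parameter: at every top pair it demands the small-field identity — and nothing on the rough fields -/

section TLaw

variable (θ : Stage13HParams F N) (p : B12.RunParams)

/-- ★★★★★ **`TLaw₁₃CoPH θ p 0` AT A PARAMETER WHOSE STEP-1 RESIDUAL FACTOR HAS THE CUT-OFF NEW-FIELD SHAPE DEMANDS, AT EVERY TOP PAIR, EXACTLY THE SMALL-FIELD IDENTITY** (served by the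
law's own witness terms `(t s′, E s′)`; Stage-13 record, `1 ≤ M`, `0 < M₂`, `0 < K`, the `α₀` guards, `ε₁η₁² + 8δ₀ ≤ α₀η₁²`): `slotT_1(s′) ≡ 0` OR old side `=` new side for a.e. `V′` with
`χ₁(s′)V′ ≠ 0` and `PlaqSmall(2α₀(Lη₁)²) V′`.  Contrast A §5 (`…_degenerate_of_lt_dist1 ∕ _su2`): under `hzh` the same law forced the 𝐓-slot to vanish a.e. on its support.
[cite: Balaban1988Convergent, Thm 1 p.262, remark p.262, Def. p.279, (3.1)–(3.5) pp.264–265, (3.25) p.270, p.267; Balaban1985Averaging, Prop. 2 (52)–(54) p.26; Balaban1987RG1, Thm 1 p.259] -/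
theorem tLaw₁₃CoPH_zero_top_pair_small_identity_of_cutoff (hM : 1 ≤ θ.τ9.M) (hM₂ : 0 < θ.ν.M₂) (hK : 0 < p.K) {α₀ : ℝ} (hα : 0 < α₀)
    (hα3 : (143 * (((((F.P p.K).d + 4 : ℕ) : ℝ)) ^ 2 / 4) ^ 2) * α₀ ≤ 1 / 3)
    (hα2 : 2 * α₀ ≤ 2 * deltaSU (Fin N) / ((((F.P p.K).d + 4) * (F.P p.K).L : ℕ) : ℝ) ^ 2)
    (hαε : epsOfRecord θ.ν (gOfRecord₁₃ F N θ.toStage13Params p) 1 * (F.P p.K).eta 1 ^ 2 + 4 * (2 * deltaOfRecord θ.ν (gOfRecord₁₃ F N θ.toStage13Params p) 0 θ.A₁) ≤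
      α₀ * (F.P p.K).eta 1 ^ 2)
    (hT : TLaw₁₃CoPH F N θ p 0)
    (s' : SeqOfRecord F θ.ν θ.τ9.M (gOfRecord₁₃ F N θ.toStage13Params p) p.K 1)
    {g : Set (Site (F.P p.K) 0) → GaugeField (F.P p.K) 1 (SU N) → ℝ} (hζ : ∀ Y ω, (θ.Zh p 1 s'.Ω s'.Λ).ζ0 0 Y ω = g Y (ω 1).1) (hΩ : s'.Ω 1 = Set.univ) (hΛ : s'.Λ 1 = Set.univ)
    (hcut : ∀ V', ¬ PlaqSmall (2 * α₀ * (((F.P p.K).L : ℝ) ^ 1 * (F.P p.K).eta 1) ^ 2) V' → g ∅ V' = 0) :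
    ∃ (u₁ : Sect2.TermValues (F.P p.K) (MatA N) (FluctV N) θ.τ9.M) (e₁ : ℝ),
      slotsTOfRecord F N θ.ν θ.τ9 (EOfRecord₁₃ F N θ.toStage13Params) (wOfRecord₉ F N θ.toStage9Params) θ.ppSel p (gOfRecord₁₃ F N θ.toStage13Params p) 1 s' = 0 ∨
        ∀ᵐ V' ∂fieldMeasure (F.P p.K) 1 (SU N),
          chiSeqOfRecord F N θ.ν θ.τ9.M (gOfRecord₁₃ F N θ.toStage13Params p) p.K 1 s' V' ≠ 0 →
            PlaqSmall (2 * α₀ * (((F.P p.K).L : ℝ) ^ 1 * (F.P p.K).eta 1) ^ 2) V' →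
              slotsTOfRecord F N θ.ν θ.τ9 (EOfRecord₁₃ F N θ.toStage13Params) (wOfRecord₉ F N θ.toStage9Params) θ.ppSel p (gOfRecord₁₃ F N θ.toStage13Params p) 1 s' V' =
                sect2Slot F N (FluctV N) p.K (settingOfRecord₁₃ F N θ.toStage13Params p) (θ.rzAt p s') (WtOfRecord₁₃H F N θ p s') s' u₁ e₁
                  (UbgOfRecord₁₃CoP F N θ.toStage13Params p 1 s') V' := by
  obtain ⟨t, Ek, -, hall⟩ := (tLaw₁₃CoPH_iff F N θ p 0).1 hT
  exact ⟨t s', Ek s', (top_O3_iff_small_of_cutoff θ p hM hM₂ hK hα hα3 hα2 hαε s' hζ hΩ hΛ hcut (t s') (Ek s')).1 (hall s').2⟩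

end TLaw


/-! ## §6. Print's (3.2) characteristic function of the new field AS the profile: `g Y V′ = 𝟙{PlaqSmall(2α₀(Lη₁)²) V′}` — `hcut` and `hone` discharged, `hzh` violated -/

section Indicator

variable (θ : Stage13HParams F N) (p : B12.RunParams)

/-- The indicator profile is CUT OFF on the rough coarse fields. [cite: Balaban1988Convergent, (3.2) p.265 (bookkeeping)] -/
theorem smallFieldIndicator_cut {δ : ℝ} {V' : GaugeField (F.P p.K) 1 (SU N)} (hV' : ¬ PlaqSmall δ V') :
    Set.indicator {W : GaugeField (F.P p.K) 1 (SU N) | PlaqSmall δ W} (1 : GaugeField (F.P p.K) 1 (SU N) → ℝ) V' = 0 :=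
  Set.indicator_of_notMem hV' _

/-- The indicator profile is `1` on the small coarse fields. [cite: Balaban1988Convergent, (3.2) p.265 (bookkeeping)] -/
theorem smallFieldIndicator_one {δ : ℝ} {V' : GaugeField (F.P p.K) 1 (SU N)} (hV' : PlaqSmall δ V') :
    Set.indicator {W : GaugeField (F.P p.K) 1 (SU N) | PlaqSmall δ W} (1 : GaugeField (F.P p.K) 1 (SU N) → ℝ) V' = 1 := by
  rw [Set.indicator_of_mem (show V' ∈ {W : GaugeField (F.P p.K) 1 (SU N) | PlaqSmall δ W} from hV'), Pi.one_apply]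

/-- The unit coarse field is `δ`-plaquette-small for every `δ > 0` (`1(∂p) = 1`, `|1 − 1| = 0`). [cite: Balaban1985Averaging, (9) p.19 (bookkeeping)] -/
theorem plaqSmall_one_of_pos {δ : ℝ} (hδ : 0 < δ) : PlaqSmall δ (1 : GaugeField (F.P p.K) 1 (SU N)) := by
  intro q
  have h1 : GaugeField.plaqHol (1 : GaugeField (F.P p.K) 1 (SU N)) q = 1 := by
    show (1 : SU N) * 1 * (1 : SU N)⁻¹ * (1 : SU N)⁻¹ = 1
    simp
  rw [h1, GaugeGroup.dist1_one]
  exact hδ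

/-- The (3.2) threshold `2α₀(Lη₁)²` of the top pair is positive for `α₀ > 0`. [cite: Balaban1988Convergent, (3.2) p.265 (bookkeeping)] -/
theorem smallFieldThreshold_pos {α₀ : ℝ} (hα : 0 < α₀) : 0 < 2 * α₀ * (((F.P p.K).L : ℝ) ^ 1 * (F.P p.K).eta 1) ^ 2 := by
  have hL : 0 < ((F.P p.K).L : ℝ) := Nat.cast_pos.2 (F.P p.K).L_pos
  have hη : 0 < (F.P p.K).eta 1 := pow_pos (inv_pos.2 hL) 1
  exact mul_pos (mul_pos two_pos hα) (pow_pos (mul_pos (pow_pos hL 1) hη) 2)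

/-- ★★ **A GENERATION-0 FACTOR OF THE NEW-FIELD SHAPE VIOLATES THE DISPLAYED ONE-SCALE LAW `hzh` AS SOON AS ITS PROFILE SEPARATES TWO COARSE FIELDS** (on 11a's base configurations,
which agree at level `0`) — so NONE of A §2–§5 applies to such a `θ`. [cite: Balaban1988Convergent, (2.18) p.257, (3.2) p.265, p.267] -/
theorem not_oneScale_of_newFieldShape_of_sep {n : ℕ} (s : SeqOfRecord F θ.ν θ.τ9.M (gOfRecord₁₃ F N θ.toStage13Params p) p.K n)
    {g : Set (Site (F.P p.K) 0) → GaugeField (F.P p.K) 1 (SU N) → ℝ} (hζ : ∀ Y ω, (θ.Zh p n s.Ω s.Λ).ζ0 0 Y ω = g Y (ω 1).1)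
    {Y : Set (Site (F.P p.K) 0)} {U U' : GaugeField (F.P p.K) 1 (SU N)} (hsep : g Y U ≠ g Y U') :
    ¬ ∀ Y ω ω', ω 0 = ω' 0 → (θ.Zh p n s.Ω s.Λ).ζ0 0 Y ω = (θ.Zh p n s.Ω s.Λ).ζ0 0 Y ω' := by
  intro h
  apply hsep
  have h1 := h Y _ _ (BalabanUVNodesN11TopPairLocalResidual.baseCfg_apply_of_ne p (V := FluctV N) zero_ne_one U U')
  rw [← WtOfRecord₁₃H_ζ_eq_ζ0 θ p s, ← WtOfRecord₁₃H_ζ_eq_ζ0 θ p s, WtOfRecord₁₃H_ζ_baseCfg_of_newFieldShape θ p s hζ,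
    WtOfRecord₁₃H_ζ_baseCfg_of_newFieldShape θ p s hζ] at h1
  exact h1

/-- ★★ **WITH THE (3.2) INDICATOR PROFILE, `hzh` FAILS AS SOON AS ONE ROUGH COARSE FIELD EXISTS** (`V₀`, displayed — g18's `…TopPairRoughSet.exists_cubeRoughStrict_of_lt_dist1` ∕
`not_plaqSmall_of_cubeRough` supply one from a group element beyond the threshold): the unit field is small (`α₀ > 0`), `V₀` is not, and the profile reads `1 ≠ 0`.
[cite: Balaban1988Convergent, (2.18) p.257, (3.2) p.265, p.267] -/
theorem not_oneScale_of_indicator {n : ℕ} (s : SeqOfRecord F θ.ν θ.τ9.M (gOfRecord₁₃ F N θ.toStage13Params p) p.K n) {α₀ : ℝ} (hα : 0 < α₀)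
    (hζ : ∀ Y ω, (θ.Zh p n s.Ω s.Λ).ζ0 0 Y ω =
      Set.indicator {W : GaugeField (F.P p.K) 1 (SU N) | PlaqSmall (2 * α₀ * (((F.P p.K).L : ℝ) ^ 1 * (F.P p.K).eta 1) ^ 2) W} 1 (ω 1).1)
    (V₀ : GaugeField (F.P p.K) 1 (SU N)) (hV₀ : ¬ PlaqSmall (2 * α₀ * (((F.P p.K).L : ℝ) ^ 1 * (F.P p.K).eta 1) ^ 2) V₀) :
    ¬ ∀ Y ω ω', ω 0 = ω' 0 → (θ.Zh p n s.Ω s.Λ).ζ0 0 Y ω = (θ.Zh p n s.Ω s.Λ).ζ0 0 Y ω' := by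
  have hsep : Set.indicator {W : GaugeField (F.P p.K) 1 (SU N) | PlaqSmall (2 * α₀ * (((F.P p.K).L : ℝ) ^ 1 * (F.P p.K).eta 1) ^ 2) W}
        (1 : GaugeField (F.P p.K) 1 (SU N) → ℝ) 1 ≠
      Set.indicator {W : GaugeField (F.P p.K) 1 (SU N) | PlaqSmall (2 * α₀ * (((F.P p.K).L : ℝ) ^ 1 * (F.P p.K).eta 1) ^ 2) W}
        (1 : GaugeField (F.P p.K) 1 (SU N) → ℝ) V₀ := by
    rw [smallFieldIndicator_one p (plaqSmall_one_of_pos p (smallFieldThreshold_pos p hα)), smallFieldIndicator_cut p hV₀]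
    exact one_ne_zero
  exact not_oneScale_of_newFieldShape_of_sep θ p s
    (g := fun _ V => Set.indicator {W : GaugeField (F.P p.K) 1 (SU N) | PlaqSmall (2 * α₀ * (((F.P p.K).L : ℝ) ^ 1 * (F.P p.K).eta 1) ^ 2) W} 1 V)
    hζ (Y := ∅) hsep

/-- ★★★★★ **THE TOP PAIR AT A PARAMETER WHOSE STEP-1 RESIDUAL FACTOR IS THE (3.2) CHARACTERISTIC FUNCTION OF THE NEW FIELD** (Stage-13 record, `1 ≤ M`, `0 < M₂`, `0 < K`, the `α₀`
guards, `ε₁η₁² + 8δ₀ ≤ α₀η₁²`; `s′ = (𝕋, 𝕋)`): (O3′) ⟺ `slotT_1(s′) ≡ 0` OR, for a.e. `V′` with `χ₁(s′)V′ ≠ 0` and `PlaqSmall(2α₀(Lη₁)²) V′`,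
`𝐓ρ₀(𝕋,𝕋)(V′) = e^{−½quad_0(𝕋)(base₁V′)} · exp A_1(s′; u₁, (∅,0), e₁)(U_1(V′))` — §4 with `hcut`∕`hone` DISCHARGED by the indicator.  The right-hand side is the SHAPE of [III] Thm 1 ∕
[I] Thm 1 (0.22)–(0.25) on the small fields, DISPLAYED (never claimed). [cite: Balaban1988Convergent, Thm 1 p.262, (3.1)–(3.5) pp.264–265, (3.25) p.270, p.267; Balaban1985Averaging, Prop. 2 (52)–(54) p.26; Balaban1987RG1, Thm 1 p.259, (0.22)–(0.25) p.253] -/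
theorem top_O3_iff_main_term_on_small_of_indicatorShape (hM : 1 ≤ θ.τ9.M) (hM₂ : 0 < θ.ν.M₂) (hK : 0 < p.K) {α₀ : ℝ} (hα : 0 < α₀)
    (hα3 : (143 * (((((F.P p.K).d + 4 : ℕ) : ℝ)) ^ 2 / 4) ^ 2) * α₀ ≤ 1 / 3)
    (hα2 : 2 * α₀ ≤ 2 * deltaSU (Fin N) / ((((F.P p.K).d + 4) * (F.P p.K).L : ℕ) : ℝ) ^ 2)
    (hαε : epsOfRecord θ.ν (gOfRecord₁₃ F N θ.toStage13Params p) 1 * (F.P p.K).eta 1 ^ 2 + 4 * (2 * deltaOfRecord θ.ν (gOfRecord₁₃ F N θ.toStage13Params p) 0 θ.A₁) ≤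
      α₀ * (F.P p.K).eta 1 ^ 2)
    (s' : SeqOfRecord F θ.ν θ.τ9.M (gOfRecord₁₃ F N θ.toStage13Params p) p.K 1)
    (hζ : ∀ Y ω, (θ.Zh p 1 s'.Ω s'.Λ).ζ0 0 Y ω =
      Set.indicator {W : GaugeField (F.P p.K) 1 (SU N) | PlaqSmall (2 * α₀ * (((F.P p.K).L : ℝ) ^ 1 * (F.P p.K).eta 1) ^ 2) W} 1 (ω 1).1)
    (hΩ : s'.Ω 1 = Set.univ) (hΛ : s'.Λ 1 = Set.univ) (u₁ : Sect2.TermValues (F.P p.K) (MatA N) (FluctV N) θ.τ9.M) (e₁ : ℝ) :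
    (slotsTOfRecord F N θ.ν θ.τ9 (EOfRecord₁₃ F N θ.toStage13Params) (wOfRecord₉ F N θ.toStage9Params) θ.ppSel p (gOfRecord₁₃ F N θ.toStage13Params p) 1 s' = 0 ∨
      ∀ᵐ V' ∂fieldMeasure (F.P p.K) 1 (SU N),
        chiSeqOfRecord F N θ.ν θ.τ9.M (gOfRecord₁₃ F N θ.toStage13Params p) p.K 1 s' V' ≠ 0 →
          slotsTOfRecord F N θ.ν θ.τ9 (EOfRecord₁₃ F N θ.toStage13Params) (wOfRecord₉ F N θ.toStage9Params) θ.ppSel p (gOfRecord₁₃ F N θ.toStage13Params p) 1 s' V' =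
            sect2Slot F N (FluctV N) p.K (settingOfRecord₁₃ F N θ.toStage13Params p) (θ.rzAt p s') (WtOfRecord₁₃H F N θ p s') s' u₁ e₁
              (UbgOfRecord₁₃CoP F N θ.toStage13Params p 1 s') V') ↔
    (slotsTOfRecord F N θ.ν θ.τ9 (EOfRecord₁₃ F N θ.toStage13Params) (wOfRecord₉ F N θ.toStage9Params) θ.ppSel p (gOfRecord₁₃ F N θ.toStage13Params p) 1 s' = 0 ∨
      ∀ᵐ V' ∂fieldMeasure (F.P p.K) 1 (SU N),
        chiSeqOfRecord F N θ.ν θ.τ9.M (gOfRecord₁₃ F N θ.toStage13Params p) p.K 1 s' V' ≠ 0 →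
          PlaqSmall (2 * α₀ * (((F.P p.K).L : ℝ) ^ 1 * (F.P p.K).eta 1) ^ 2) V' →
            slotsTOfRecord F N θ.ν θ.τ9 (EOfRecord₁₃ F N θ.toStage13Params) (wOfRecord₉ F N θ.toStage9Params) θ.ppSel p (gOfRecord₁₃ F N θ.toStage13Params p) 1 s' V' =
              Real.exp (-(1 / 2 : ℝ) * (θ.Zh p 1 s'.Ω s'.Λ).quad 0 Set.univ (baseCfg (V := FluctV N) 1 V')) *
                Real.exp ((sect2ActionDataOfRecord F N (FluctV N) p.K (settingOfRecord₁₃ F N θ.toStage13Params p) (θ.rzAt p s') s' u₁ (fun _ => ∅, fun _ => 0) e₁).action23 1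
                  (UbgOfRecord₁₃CoP F N θ.toStage13Params p 1 s' (fun j => ((baseCfg (V := FluctV N) 1 V') j).1)))) := by
  rw [top_O3_iff_small_of_cutoff θ p hM hM₂ hK hα hα3 hα2 hαε s'
    (g := fun _ V => Set.indicator {W : GaugeField (F.P p.K) 1 (SU N) | PlaqSmall (2 * α₀ * (((F.P p.K).L : ℝ) ^ 1 * (F.P p.K).eta 1) ^ 2) W} 1 V)
    hζ hΩ hΛ (fun _ hV' => smallFieldIndicator_cut p hV') u₁ e₁]
  refine or_congr_right (Filter.eventually_congr (Filter.Eventually.of_forall fun V' => ?_))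
  refine imp_congr_right fun _ => imp_congr_right fun hs => ?_
  rw [sect2Slot_top_pair_eq_main_of_indicator θ p s'
    (g := fun _ V => Set.indicator {W : GaugeField (F.P p.K) 1 (SU N) | PlaqSmall (2 * α₀ * (((F.P p.K).L : ℝ) ^ 1 * (F.P p.K).eta 1) ^ 2) W} 1 V)
    hζ hΩ hΛ (fun _ hV' => smallFieldIndicator_one p hV') _ _ u₁ e₁ _ hs]

end Indicator

end Summit.QuantumFields.YangMills.Theorems.BalabanUVNodesN11TopPairAtNewFieldShape

end
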